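import Summits.BirchSwinnertonDyer.BirchSwinnertonDyer.Theorems.KolyvaginRankRigidityAtTwoTransverseClassAtTwo
import Summits.BirchSwinnertonDyer.BirchSwinnertonDyer.Theorems.KolyvaginRankRigidityAtTwoTransverseLagrangianAtTwo
import Summits.BirchSwinnertonDyer.Rank1Residual.X11b.BDPRouteRelaxation
import HarnessLib

/-!
# Route `GenusKolyvaginAtTwo`, crux L_T `PowDvdShaCardAtTwoRT` (stmt-BirchSwinnertonDyer-23242), LINE 18 stub KS, the DROPS, input `hrec` —
# THE COMMON-OWN-PRIME TERMS OF KOLYVAGIN'S TWO-TERM RECIPROCITY VANISH AT `p = 2` (margin one, UNCONDITIONAL)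

Seat `bsd-line-gk2-p3` g23 (PROVER seat 3/3, cell `bsd-f1-sign2`), `--supports stmt-BirchSwinnertonDyer-23242` (helper; closes nothing).
THEOREMS ONLY (no definition, no named fact, no `sorry`).  BSD is NOT proved by any of this; neither is the crux nor any stub.

WHY.  In Kolyvagin's two-term identity (Math. Ann. 291 (1991) Thm. 2.1; the input `hrec` of gk2-p2's
`PlusDescent.weakSwapOracle_of_twoPrimeReciprocity`) the Poitou–Tate sum for the pair `(c_M(nℓ′), c_M(nℓ₀))` over the Heegner field has,
besides the two surviving terms at `λ′` and `λ₀`, terms at the COMMON own primes `λ ∣ ℓ ∣ n` of the two classes.  THIS FILE kills them,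
with NO reduction-datum / (V44) hypothesis, by assembling two theorems of the KRR cell (route `KolyvaginRankRigidityAtTwo`):
* Kolyvagin's class is TRANSVERSE at the primes of its conductor at `2` with MARGIN ONE (`M + 1 ≤ M(ℓ)`):
  `JET.localization_kolyvaginClass_mem_globalTransverse_two` (Howard 2004 Lemma 2.7.3 at `2`; unconditional on the tree's `KolyvaginHeegnerData`);
* the ring-class transverse condition is ISOTROPIC at `2` with margin one:
  `KolyvaginLowerBoundAtTwo.weilCupProduct_eq_zero_of_mem_transverseSubgroup_ringClassField_two` (Mazur–Rubin Prop. 1.3.2 (ii)).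
* **`invWeilPairing_localization_kolyvaginClass_eq_zero_of_common_prime`** — for square-free `c`, `c′` all of whose prime factors are
  Zhang–Kolyvagin primes at `2` of index `≥ M + 1`, data `d` at `c` and `d′` at `c′`, and a prime `ℓ ∣ c`, `ℓ ∣ c′` with place `λ ∋ ℓ`:
  `inv_λ(loc_λ c_M(c) ∪ₑ loc_λ c_M(c′)) = 0` for every Weil datum `e` and every family `inv`.
So at `p = 2` the common-prime terms cost NOTHING beyond margin one at those primes (the swap loop chooses its primes at depth `≥ L + 1`).

References: [Kolyvagin1991MathAnn] Thm. 2.1; [Howard2004HeegnerKolyvagin] Lemma 2.7.3, Prop. 2.1.9 (ii); [MazurRubin2004] Prop. 1.3.2 (ii);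
[Jetchev2008] §3.1.2, Prop. 4.6; [McCallumLMS1991] §5 Lemma 5.3 and (13).
-/

set_option autoImplicit false

noncomputable section

open scoped Classical
open WeierstrassCurve Field Function NumberField IsDedekindDomain
open Literature.NumberTheory.EllipticCurves Literature.NumberTheory.EllipticCurves.Jetchev2008
open Literature.NumberTheory.EllipticCurves.ModularForms Literature.NumberTheory.EllipticCurves.RingClassField
open Literature.NumberTheory.GaloisRepresentations Literature.NumberTheory.GaloisCohomology
open Literature.NumberTheory.GaloisRepresentations.DiscreteGaloisModule (transverseSubgroup SelmerStructure)
open Summit.BirchSwinnertonDyer.Rank1Residual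
open Summit.BirchSwinnertonDyer.Rank1Residual.X11b.Relaxation
open Summit.BirchSwinnertonDyer.Rank1Residual.JET.SelmerVocabulary

-- the Theorems namespace of this sub repeats the summit name by design (D-0017 nested layout)
set_option linter.dupNamespace false

namespace Summit.BirchSwinnertonDyer.BirchSwinnertonDyer.Theorems.GenusExact.PlusDescent

variable (W : WeierstrassCurve ℚ) [W.IsElliptic] [W.IsGloballyMinimal] [NeZero (W.conductorNorm ℤ)]
  (K : Type) [Field K] [NumberField K]

/-- **The common-own-prime terms of Kolyvagin's two-term reciprocity vanish at `p = 2` (margin one).**  `K` imaginary quadratic with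
`d_K < −4`; `c`, `c′` square-free products of Zhang–Kolyvagin primes at `2` of index `≥ M + 1`; `d`, `d′` the tree's Kolyvagin–Heegner data at
`c`, `c′`; `ℓ ∣ c`, `ℓ ∣ c′`, `λ ∋ ℓ`.  Then `inv_λ(loc_λ c_M(c) ∪ₑ loc_λ c_M(c′)) = 0` for every Weil datum `e` and family `inv`: both
localisations lie in the ring-class transverse condition at `λ` (Howard Lemma 2.7.3 at `2`), which is isotropic (margin one).
[cite: Kolyvagin1991MathAnn, Thm. 2.1] [cite: Howard2004HeegnerKolyvagin, Lemma 2.7.3, Prop. 2.1.9 (ii)] [cite: MazurRubin2004, Prop. 1.3.2 (ii)] -/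
theorem invWeilPairing_localization_kolyvaginClass_eq_zero_of_common_prime (hK : IsImaginaryQuadratic K)
    (hD : NumberField.discr K < -4)
    (Dt : ModularParametrizationData W (W.conductorNorm ℤ)) (β : ℤ) (ι : K →+* ℂ)
    [∀ j : ℕ, NumberField (ringClassField K ι j)] (M : ℕ)
    {c c' : ℕ} (d : KolyvaginHeegnerData Dt β ι c) (d' : KolyvaginHeegnerData Dt β ι c')
    (hc : KolyvaginDescent.KolSupp (Zhang2014.IsKolyvaginPrime (W.conductorNorm ℤ) W K 2) c)
    (hc' : KolyvaginDescent.KolSupp (Zhang2014.IsKolyvaginPrime (W.conductorNorm ℤ) W K 2) c')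
    (hcM : ∀ q ∈ c.primeFactors, M + 1 ≤ Zhang2014.kolyvaginIndex W 2 q)
    (hc'M : ∀ q ∈ c'.primeFactors, M + 1 ≤ Zhang2014.kolyvaginIndex W 2 q)
    {ℓ : ℕ} (hℓc : ℓ ∈ c.primeFactors) (hℓc' : ℓ ∈ c'.primeFactors)
    (v : HeightOneSpectrum (𝓞 K)) (hv : (ℓ : 𝓞 K) ∈ v.asIdeal)
    (e : geomTorsion (W.baseChange K) ((2 ^ M : ℕ) : ℤ) → geomTorsion (W.baseChange K) ((2 ^ M : ℕ) : ℤ) → AlgebraicClosure K)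
    (hμ : ∀ S T, e S T ^ (2 ^ M) = 1)
    (hadd₁ : ∀ S₁ S₂ T, e (S₁ + S₂) T = e S₁ T * e S₂ T)
    (hadd₂ : ∀ S T₁ T₂, e S (T₁ + T₂) = e S T₁ * e S T₂)
    (hgal : ∀ (g : absoluteGaloisGroup K) (S T : geomTorsion (W.baseChange K) ((2 ^ M : ℕ) : ℤ)), g • e S T = e (g • S) (g • T))
    (inv : LocalInvariants K (2 ^ M)) :
    invWeilPairing (W.baseChange K) (2 ^ M) e hμ hadd₁ hadd₂ hgal inv (Sum.inr v)
        (galoisCohomology.localization ((W.baseChange K).torsionGaloisModule ((2 ^ M : ℕ) : ℤ)) (Sum.inr v : Place K) 1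
          (d.kolyvaginClass Nat.prime_two M))
        (galoisCohomology.localization ((W.baseChange K).torsionGaloisModule ((2 ^ M : ℕ) : ℤ)) (Sum.inr v : Place K) 1
          (d'.kolyvaginClass Nat.prime_two M)) = 0 := by
  haveI : Fact (Nat.Prime 2) := ⟨Nat.prime_two⟩
  haveI : CompactSpace (absoluteGaloisGroup (Place.Completion (Sum.inr v : Place K))) := absoluteGaloisGroup_compactSpace _
  have hℓ : Zhang2014.IsKolyvaginPrime (W.conductorNorm ℤ) W K 2 ℓ := hc.2 ℓ hℓc
  have hℓp : ℓ.Prime := hℓ.1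
  have hℓ0 : ℓ ≠ 0 := hℓp.ne_zero
  -- the global intrinsic transverse family of level `2^M`
  obtain ⟨𝒯, h𝒯, -⟩ := JET.Walk.exists_globalTransverseFamily (W := W) (K := K) ι (((2 ^ M : ℕ) : ℤ))
  -- both classes are transverse at `λ` (margin one)
  have hvc : v ∈ placesDividing K c :=
    (mem_placesDividing_iff_natCast_mem hc.1.ne_zero v).mpr
      ((natCast_mem_iff_exists_primeFactor_mem hc.1.ne_zero v).mpr ⟨ℓ, hℓc, hv⟩)
  have hvc' : v ∈ placesDividing K c' :=
    (mem_placesDividing_iff_natCast_mem hc'.1.ne_zero v).mpr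
      ((natCast_mem_iff_exists_primeFactor_mem hc'.1.ne_zero v).mpr ⟨ℓ, hℓc', hv⟩)
  have ha := JET.localization_kolyvaginClass_mem_globalTransverse_two W hK hD Dt β ι M h𝒯 d hc hcM v hvc
  have hb := JET.localization_kolyvaginClass_mem_globalTransverse_two W hK hD Dt β ι M h𝒯 d' hc' hc'M v hvc'
  -- a place `w₀ ∣ λ` of `K[ℓ]`; `𝒯_λ` is (contained in) the transverse subgroup at `w₀`
  haveI := (finiteDimensional_and_isGalois_ringClassField hK ι hℓ0).2
  obtain ⟨w₀⟩ := (inferInstance : Nonempty (SemiLocal.Place K (ringClassField K ι ℓ) v))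
  haveI hw₀ : (w₀ : HeightOneSpectrum (𝓞 (ringClassField K ι ℓ))).asIdeal.LiesOver v.asIdeal := SemiLocal.Place.liesOver w₀
  rw [JET.Walk.globalTransverse_eq_of_natCast_mem h𝒯 v hℓp hv] at ha hb
  have ha' := (AddSubgroup.mem_iInf.mp ((AddSubgroup.mem_iInf.mp ha) (w₀ : HeightOneSpectrum (𝓞 (ringClassField K ι ℓ))))) hw₀
  have hb' := (AddSubgroup.mem_iInf.mp ((AddSubgroup.mem_iInf.mp hb) (w₀ : HeightOneSpectrum (𝓞 (ringClassField K ι ℓ))))) hw₀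
  -- isotropy of the transverse condition (margin one)
  rw [invWeilPairing_apply]
  have h0 := KolyvaginLowerBoundAtTwo.weilCupProduct_eq_zero_of_mem_transverseSubgroup_ringClassField_two W K hK hD ι M hℓ
    (hcM ℓ hℓc) v hv (w₀ : HeightOneSpectrum (𝓞 (ringClassField K ι ℓ))) e hμ hadd₁ hadd₂ hgal ha' hb'
  rw [h0]
  exact map_zero (inv (Sum.inr v))

end Summit.BirchSwinnertonDyer.BirchSwinnertonDyer.Theorems.GenusExact.PlusDescent

end
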